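import Summits.NavierStokesRegularity.NavierStokesRegularity.Theorems.HarmonicShellPolynomial
import Literature.Algebra.EuclideanLattices.FccBccLattices
import HarnessLib

/-!
# HarmonicShellZonal — plate Z of ROUND-41 «IsotropicBlobPressureLaw» (S-door lane):
# the zonal harmonics `Z₂ = 2z² − x² − y²` and `Z₄ = 8z⁴ − 24z²(x²+y²) + 3(x²+y²)²` BY NAME

As `MvPolynomial (Fin 3) ℝ` (coordinates `X 0, X 1, X 2` = `x, y, z`) with their polynomial functions
`polyFun zonal2`, `polyFun zonal4` on `EuclideanSpace ℝ (Fin 3)` (plate P `HarmonicShellPolynomial`):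
explicit values, homogeneity (`IsHomogeneous` 2 / 4), HARMONICITY (`Σᵢ ∂ᵢ∂ᵢ = 0` as an `MvPolynomial` identity,
hence `Δ (polyFun zonal_l) = 0` everywhere), the EULER identities `⟪x, ∇Z_l(x)⟫ = l·Z_l(x)`, smoothness, the values
`Z_l(0) = 0`, and the growth bounds `|Z₂(x)| ≤ 2‖x‖²`, `|Z₄(x)| ≤ 35‖x‖⁴` (decay of the multipoles `Z_l/‖x‖^{2l+1}`).
These are exactly the `h`-hypotheses of plates E0/E1/E2 (`HarmonicShellLaplacian`) and R (`HarmonicShellRadial`)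
for the ROUND-41 witness pressure `p = Φ₀(‖x‖²) + Φ₂(‖x‖²)Z₂ + Φ₄(‖x‖²)Z₄` (nsreg-p1 g33 «Glue1D»).

Generic; `--supports stmt-NavierStokesRegularity-0056 --as helper`.
HONEST FRAME: elementary algebra/calculus; nothing about item 0056 `NoTypeII` or NS regularity is proved.
-/

set_option linter.dupNamespace false

open Set Function MvPolynomial InnerProductSpace
open scoped RealInnerProductSpace Laplacian ContDiff

namespace Summit.NavierStokesRegularity.NavierStokesRegularity.Theorems.StrainDoors

namespace HarmonicShell

noncomputable section

/-- support (definition): the zonal harmonic of degree 2, `Z₂ = 2z² − x² − y²`, as a polynomial. -/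
def zonal2 : MvPolynomial (Fin 3) ℝ := 2 * X 2 ^ 2 - X 0 ^ 2 - X 1 ^ 2

/-- support (definition): the zonal harmonic of degree 4, `Z₄ = 8z⁴ − 24z²(x²+y²) + 3(x²+y²)²`, as a polynomial. -/
def zonal4 : MvPolynomial (Fin 3) ℝ :=
  8 * X 2 ^ 4 - 24 * X 2 ^ 2 * (X 0 ^ 2 + X 1 ^ 2) + 3 * (X 0 ^ 2 + X 1 ^ 2) ^ 2

/-- `Z₂(x) = 2x₂² − x₀² − x₁²`. -/
@[simp] theorem polyFun_zonal2 (x : EuclideanSpace ℝ (Fin 3)) :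
    polyFun zonal2 x = 2 * x 2 ^ 2 - x 0 ^ 2 - x 1 ^ 2 := by
  simp [zonal2, polyFun_apply]

/-- `Z₄(x) = 8x₂⁴ − 24x₂²(x₀²+x₁²) + 3(x₀²+x₁²)²`. -/
@[simp] theorem polyFun_zonal4 (x : EuclideanSpace ℝ (Fin 3)) :
    polyFun zonal4 x = 8 * x 2 ^ 4 - 24 * x 2 ^ 2 * (x 0 ^ 2 + x 1 ^ 2) + 3 * (x 0 ^ 2 + x 1 ^ 2) ^ 2 := by
  simp [zonal4, polyFun_apply]

/-- `Z₂(0) = 0`. -/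
theorem polyFun_zonal2_zero : polyFun zonal2 0 = 0 := by simp

/-- `Z₄(0) = 0`. -/
theorem polyFun_zonal4_zero : polyFun zonal4 0 = 0 := by simp

/-! ## Homogeneity and the Euler identities -/

/-- `Z₂` is homogeneous of degree 2. -/
theorem isHomogeneous_zonal2 : zonal2.IsHomogeneous 2 := by
  have hX : ∀ i : Fin 3, ((X i : MvPolynomial (Fin 3) ℝ) ^ 2).IsHomogeneous 2 := fun i => by
    simpa using (isHomogeneous_X ℝ i).pow 2
  have h2 : (2 * X 2 ^ 2 : MvPolynomial (Fin 3) ℝ).IsHomogeneous 2 := by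
    have h := (isHomogeneous_C (Fin 3) (2 : ℝ)).mul (hX 2)
    rw [map_ofNat] at h
    simpa using h
  exact (h2.sub (hX 0)).sub (hX 1)

/-- `Z₄` is homogeneous of degree 4. -/
theorem isHomogeneous_zonal4 : zonal4.IsHomogeneous 4 := by
  have hX : ∀ i : Fin 3, ((X i : MvPolynomial (Fin 3) ℝ) ^ 2).IsHomogeneous 2 := fun i => by
    simpa using (isHomogeneous_X ℝ i).pow 2
  have hX4 : ((X 2 : MvPolynomial (Fin 3) ℝ) ^ 4).IsHomogeneous 4 := by
    simpa using (isHomogeneous_X ℝ (2 : Fin 3)).pow 4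
  have hρ : (X 0 ^ 2 + X 1 ^ 2 : MvPolynomial (Fin 3) ℝ).IsHomogeneous 2 := (hX 0).add (hX 1)
  have hC : ∀ (n : ℕ) [n.AtLeastTwo], (OfNat.ofNat n : MvPolynomial (Fin 3) ℝ).IsHomogeneous 0 := by
    intro n _
    have h := isHomogeneous_C (Fin 3) (OfNat.ofNat n : ℝ)
    rwa [map_ofNat] at h
  have h1 : (8 * X 2 ^ 4 : MvPolynomial (Fin 3) ℝ).IsHomogeneous 4 := by
    simpa using (hC 8).mul hX4
  have h2 : (24 * X 2 ^ 2 * (X 0 ^ 2 + X 1 ^ 2) : MvPolynomial (Fin 3) ℝ).IsHomogeneous 4 := by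
    simpa using ((hC 24).mul (hX 2)).mul hρ
  have h3 : (3 * (X 0 ^ 2 + X 1 ^ 2) ^ 2 : MvPolynomial (Fin 3) ℝ).IsHomogeneous 4 := by
    simpa using (hC 3).mul (hρ.pow 2)
  exact (h1.sub h2).add h3

/-- **Euler identity for `Z₂`**: `⟪x, ∇Z₂(x)⟫ = 2·Z₂(x)`. -/
theorem inner_gradient_zonal2 (x : EuclideanSpace ℝ (Fin 3)) :
    ⟪x, gradient (polyFun zonal2) x⟫ = 2 * polyFun zonal2 x := by
  have h := inner_self_gradient_polyFun_of_isHomogeneous isHomogeneous_zonal2 x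
  simpa using h

/-- **Euler identity for `Z₄`**: `⟪x, ∇Z₄(x)⟫ = 4·Z₄(x)`. -/
theorem inner_gradient_zonal4 (x : EuclideanSpace ℝ (Fin 3)) :
    ⟪x, gradient (polyFun zonal4) x⟫ = 4 * polyFun zonal4 x := by
  have h := inner_self_gradient_polyFun_of_isHomogeneous isHomogeneous_zonal4 x
  simpa using h

/-! ## Harmonicity -/

/-- Partial derivatives kill numerals. -/
@[simp] theorem pderiv_ofNat (i : Fin 3) (n : ℕ) [n.AtLeastTwo] :
    pderiv i (ofNat(n) : MvPolynomial (Fin 3) ℝ) = 0 := by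
  rw [← map_ofNat (C : ℝ →+* MvPolynomial (Fin 3) ℝ) n, pderiv_C]

/-- The partial derivatives of `Z₂`. -/
theorem pderiv_zonal2 (i : Fin 3) :
    pderiv i zonal2 = if i = 2 then 4 * X 2 else -(2 * X i) := by
  fin_cases i <;>
    simp [zonal2, Derivation.leibniz_pow, Derivation.leibniz, pderiv_X, smul_eq_mul, nsmul_eq_mul, map_sub]
  ring

/-- `Σᵢ ∂ᵢ∂ᵢ Z₂ = 0` in `MvPolynomial (Fin 3) ℝ`. -/
theorem sum_pderiv_pderiv_zonal2 : ∑ i : Fin 3, pderiv i (pderiv i zonal2) = 0 := by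
  simp only [Fin.sum_univ_three, pderiv_zonal2]
  simp [pderiv_X, map_neg, Derivation.leibniz]
  ring

/-- The partial derivatives of `Z₄`. -/
theorem pderiv_zonal4 (i : Fin 3) :
    pderiv i zonal4 =
      if i = 2 then 32 * X 2 ^ 3 - 48 * X 2 * (X 0 ^ 2 + X 1 ^ 2)
      else -(48 * X 2 ^ 2 * X i) + 12 * (X 0 ^ 2 + X 1 ^ 2) * X i := by
  fin_cases i <;>
    simp [zonal4, Derivation.leibniz_pow, Derivation.leibniz, pderiv_X, smul_eq_mul, nsmul_eq_mul,
      map_sub, map_add] <;> ring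

/-- `Σᵢ ∂ᵢ∂ᵢ Z₄ = 0` in `MvPolynomial (Fin 3) ℝ`. -/
theorem sum_pderiv_pderiv_zonal4 : ∑ i : Fin 3, pderiv i (pderiv i zonal4) = 0 := by
  simp only [Fin.sum_univ_three, pderiv_zonal4]
  simp [Derivation.leibniz_pow, Derivation.leibniz, pderiv_X, smul_eq_mul, nsmul_eq_mul, map_neg, map_sub,
    map_add]
  ring

/-- **`Z₂` is harmonic**: `Δ Z₂ ≡ 0` on `ℝ³`. -/
theorem laplacian_zonal2 (x : EuclideanSpace ℝ (Fin 3)) : Δ (polyFun zonal2) x = 0 :=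
  laplacian_polyFun_eq_zero sum_pderiv_pderiv_zonal2 x

/-- **`Z₄` is harmonic**: `Δ Z₄ ≡ 0` on `ℝ³`. -/
theorem laplacian_zonal4 (x : EuclideanSpace ℝ (Fin 3)) : Δ (polyFun zonal4) x = 0 :=
  laplacian_polyFun_eq_zero sum_pderiv_pderiv_zonal4 x

/-! ## Smoothness and growth -/

/-- `Z₂` is `C^n`. -/
theorem contDiff_zonal2 {n : WithTop ℕ∞} : ContDiff ℝ n (polyFun zonal2) := contDiff_polyFun _

/-- `Z₄` is `C^n`. -/
theorem contDiff_zonal4 {n : WithTop ℕ∞} : ContDiff ℝ n (polyFun zonal4) := contDiff_polyFun _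

/-- **Growth of `Z₂`**: `|Z₂(x)| ≤ 2‖x‖²`. -/
theorem abs_polyFun_zonal2_le (x : EuclideanSpace ℝ (Fin 3)) : |polyFun zonal2 x| ≤ 2 * ‖x‖ ^ 2 := by
  rw [polyFun_zonal2, Literature.Algebra.EuclideanLattices.norm_sq_fin_three, abs_le]
  constructor <;> nlinarith [sq_nonneg (x 0), sq_nonneg (x 1), sq_nonneg (x 2)]

/-- **Growth of `Z₄`**: `|Z₄(x)| ≤ 35‖x‖⁴`. -/
theorem abs_polyFun_zonal4_le (x : EuclideanSpace ℝ (Fin 3)) : |polyFun zonal4 x| ≤ 35 * ‖x‖ ^ 4 := by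
  have h4 : ‖x‖ ^ 4 = (x 0 ^ 2 + x 1 ^ 2 + x 2 ^ 2) ^ 2 := by
    rw [← Literature.Algebra.EuclideanLattices.norm_sq_fin_three]; ring
  rw [polyFun_zonal4, h4, abs_le]
  have h0 := sq_nonneg (x 0)
  have h1 := sq_nonneg (x 1)
  have h2 := sq_nonneg (x 2)
  constructor <;> nlinarith [mul_nonneg h0 h1, mul_nonneg h0 h2, mul_nonneg h1 h2, mul_nonneg h2 h2,
    mul_nonneg (add_nonneg h0 h1) (add_nonneg h0 h1)]

end

end HarmonicShell

end Summit.NavierStokesRegularity.NavierStokesRegularity.Theorems.StrainDoors
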